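import Summits.QuantumFields.YangMills.Theorems.VirialFluxGapCombShadow
import Summits.QuantumFields.YangMills.Theorems.VirialFluxGapCentralProjection
import HarnessLib

/-!
# Route `VirialFluxGap` (YangMills): the central lift is Lipschitz on a hemisphere, and the shadow data of a ring history are close to the
# central lifts of its block averages (central coercivity, part II-a; free-hands helper toward crux ⟨stmt-QuantumFields-24141⟩ `PeriodicSoftness`)

Width seat `ym-line-sfw-p2-w3` g59 (cell ym-idea-1, free hands; own crux ⟨22884⟩ has no free stub), `--supports stmt-QuantumFields-24141`.

Part I (✓`…VirialFluxGapCombShadow`) puts every ring history `P` with slice `0` in comb gauge within `16L²·√F₀(P)` per variable of its comb shadow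
`K(P) = ((fun _ => combFlat (wrapReps (P.1 0))), fun _ => P.2 0)`.  The central chart of the ⟨24141⟩ Euler field is written at the CENTRAL
PROJECTION `π_C P = centralProj L σ σ₄ P` (✓`FrameDerivative.centralProj`), whose representatives are the central lifts `liftQuat σ_B z_B =
(σ_B√(1 − |z_B|²), z_B)` of the wrap-block ∕ seam AVERAGES `z_B` of the imaginary parts.  This file compares the two sets of representatives:

* §1 quaternion lemmas: `im_sub_sq_le_norm_sub_sq`, `dot3_sq_le`, `radial_arg_sub_sq_le`, `sqrt_sub_sqrt_sq_le`, `norm_liftQuat_sub_liftQuat_sq`,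
  ★ `liftQuat_sub_liftQuat_sq_le` (the central lift is `√17`-Lipschitz in `z` on a hemisphere half: `‖lift σ v − lift σ z‖² ≤ 17·|v − z|²` when
  `√(1−|v|²) ≥ ½`), ★ `su2Quat_sub_liftQuat_sq_le` (`‖q(U) − lift σ z‖² ≤ 17·|Im q(U) − z|²` when `σ·Re q(U) ≥ ½`), `avg_sub_sq_le` (Jensen for
  block averages), `norm_comm_sub_comm_le` (the quaternion commutator is `2`-Lipschitz in each unit argument);
* §2 ★★ `norm_sq_wrapRep_sub_lift_blockIm_le` — with slice `0` in comb gauge and `σ_k·Re q(w_k) ≥ ½`: `‖q(w_k) − lift σ_k z_k‖² ≤ 17·(16L²·√F₀(P))²`,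
  `z_k = blockIm (wrapBlock k) k P`; ★★ `norm_sq_seam_sub_lift_seamIm_le` — `‖q(P.2 0) − lift σ₄ z₄‖² ≤ 17·(12L²·√F₀(P))²`, `z₄ = seamIm P`.

Part II-b (`…VirialFluxGapCentralCoercivity`) turns these into `‖P − π_C P‖² ≤ 60480·L⁸·F₀(P)` and `F₀(π_C P) ≤ 880000·L⁶·F₀(P)`.

HONEST LABEL: quaternion ∕ lattice inequalities (zero ℏ), helpers for a RECORD-label crux of a DRAFT route; the Euler field is NOT assembled; ⟨24141⟩ and
⟨22884⟩ stay OPEN; no stub ∕ crux ∕ rung ∕ summit is closed; the Yang–Mills mass gap is NOT proved by this; no summit is proved by a line.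
THEOREMS ONLY (no `def`, no `sorry`).

References: M. Lüscher, Nucl. Phys. B 219 (1983) 233–261, §2 [Luscher1983]; A. Coste, A. González-Arroyo, J. Jurkiewicz, C. P. Korthals Altes,
Nucl. Phys. B 262 (1985) 67–94 [CosteEtAl1985].
-/

set_option autoImplicit false

noncomputable section

open scoped Quaternion Matrix BigOperators
open Literature.MathematicalPhysics.QuantumFieldTheory hiding SU2
open Literature.MathematicalPhysics.QuantumLattice

namespace Summit.QuantumFields.YangMills.Theorems.VirialFluxGap.CentralCoercivity

open Summit.QuantumFields.YangMills.Theorems.FemtoTransferGap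
open Summit.QuantumFields.YangMills.Theorems.FemtoTransferGap.TT
open Summit.QuantumFields.YangMills.Theorems.FemtoTransferGap.TwoLattice
open Summit.QuantumFields.YangMills.Theorems.FemtoTransferGap.TwoLattice.Flat
open Summit.QuantumFields.YangMills.Theorems.FemtoTransferGap.TwoLattice.Cov
open Summit.QuantumFields.YangMills.Theorems.VirialFluxGap.RingDeficit
open Summit.QuantumFields.YangMills.Theorems.VirialFluxGap.CombConstant
open Summit.QuantumFields.YangMills.Theorems.VirialFluxGap.FrameDerivative
open Summit.QuantumFields.YangMills.Theorems.ToronValleyVolume.Lojasiewicz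

variable {L : ℕ} [NeZero L]

/-! ## §1 Quaternion lemmas -/

omit [NeZero L] in
/-- The imaginary parts are `1`-Lipschitz: `Σ_a (Im_a x − Im_a y)² ≤ ‖x − y‖²`. [folklore] -/
theorem im_sub_sq_le_norm_sub_sq (x y : ℍ) :
    (x.imI - y.imI) ^ 2 + (x.imJ - y.imJ) ^ 2 + (x.imK - y.imK) ^ 2 ≤ ‖x - y‖ ^ 2 := by
  have h := norm_sq_eq_re_sq_add_imDot (x - y)
  simp only [Quaternion.re_sub, Quaternion.imI_sub, Quaternion.imJ_sub, Quaternion.imK_sub] at h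
  nlinarith [sq_nonneg (x.re - y.re)]

omit [NeZero L] in
/-- Cauchy–Schwarz in `ℝ³`, squared. [folklore] -/
theorem dot3_sq_le (a b : Fin 3 → ℝ) :
    (a 0 * b 0 + a 1 * b 1 + a 2 * b 2) ^ 2 ≤ ((a 0) ^ 2 + (a 1) ^ 2 + (a 2) ^ 2) * ((b 0) ^ 2 + (b 1) ^ 2 + (b 2) ^ 2) := by
  nlinarith [sq_nonneg (a 0 * b 1 - a 1 * b 0), sq_nonneg (a 0 * b 2 - a 2 * b 0), sq_nonneg (a 1 * b 2 - a 2 * b 1)]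

omit [NeZero L] in
/-- The radial arguments of two central lifts differ by at most `2|v − z|`: `(|z|² − |v|²)² ≤ 4|v − z|²` for `|v|², |z|² ≤ 1`. [folklore] -/
theorem radial_arg_sub_sq_le {v z : Fin 3 → ℝ}
    (hv : (v 0) ^ 2 + (v 1) ^ 2 + (v 2) ^ 2 ≤ 1) (hz : (z 0) ^ 2 + (z 1) ^ 2 + (z 2) ^ 2 ≤ 1) :
    ((1 - ((v 0) ^ 2 + (v 1) ^ 2 + (v 2) ^ 2)) - (1 - ((z 0) ^ 2 + (z 1) ^ 2 + (z 2) ^ 2))) ^ 2 ≤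
      4 * ((v 0 - z 0) ^ 2 + (v 1 - z 1) ^ 2 + (v 2 - z 2) ^ 2) := by
  have e1 : (1 - ((v 0) ^ 2 + (v 1) ^ 2 + (v 2) ^ 2)) - (1 - ((z 0) ^ 2 + (z 1) ^ 2 + (z 2) ^ 2)) =
      -((v 0 - z 0) * (v 0 + z 0) + (v 1 - z 1) * (v 1 + z 1) + (v 2 - z 2) * (v 2 + z 2)) := by ring
  have hcs := dot3_sq_le (fun a => v a - z a) (fun a => v a + z a)
  have hsum : (v 0 + z 0) ^ 2 + (v 1 + z 1) ^ 2 + (v 2 + z 2) ^ 2 ≤ 4 := by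
    nlinarith [sq_nonneg (v 0 - z 0), sq_nonneg (v 1 - z 1), sq_nonneg (v 2 - z 2)]
  have hD0 : 0 ≤ (v 0 - z 0) ^ 2 + (v 1 - z 1) ^ 2 + (v 2 - z 2) ^ 2 := by positivity
  rw [e1, neg_sq]
  calc ((v 0 - z 0) * (v 0 + z 0) + (v 1 - z 1) * (v 1 + z 1) + (v 2 - z 2) * (v 2 + z 2)) ^ 2
      ≤ ((v 0 - z 0) ^ 2 + (v 1 - z 1) ^ 2 + (v 2 - z 2) ^ 2) * ((v 0 + z 0) ^ 2 + (v 1 + z 1) ^ 2 + (v 2 + z 2) ^ 2) := hcs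
    _ ≤ ((v 0 - z 0) ^ 2 + (v 1 - z 1) ^ 2 + (v 2 - z 2) ^ 2) * 4 := mul_le_mul_of_nonneg_left hsum hD0
    _ = 4 * ((v 0 - z 0) ^ 2 + (v 1 - z 1) ^ 2 + (v 2 - z 2) ^ 2) := by ring

omit [NeZero L] in
/-- Square roots on `[½, ∞)`: `(√A − √B)² ≤ 4(A − B)²` when `√A ≥ ½` (`A, B ≥ 0`). [folklore] -/
theorem sqrt_sub_sqrt_sq_le {A B : ℝ} (hA : 0 ≤ A) (hB : 0 ≤ B) (hre : (1 / 2 : ℝ) ≤ Real.sqrt A) :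
    (Real.sqrt A - Real.sqrt B) ^ 2 ≤ 4 * (A - B) ^ 2 := by
  have hs2 : Real.sqrt A ^ 2 = A := Real.sq_sqrt hA
  have ht2 : Real.sqrt B ^ 2 = B := Real.sq_sqrt hB
  have ht0 : 0 ≤ Real.sqrt B := Real.sqrt_nonneg _
  have e2 : (Real.sqrt A - Real.sqrt B) ^ 2 * (Real.sqrt A + Real.sqrt B) ^ 2 = (A - B) ^ 2 := by
    have e3 : (Real.sqrt A - Real.sqrt B) ^ 2 * (Real.sqrt A + Real.sqrt B) ^ 2 = (Real.sqrt A ^ 2 - Real.sqrt B ^ 2) ^ 2 := by ring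
    rw [e3, hs2, ht2]
  have hst : (1 / 2 : ℝ) ≤ Real.sqrt A + Real.sqrt B := by linarith
  have hsum : (1 / 4 : ℝ) ≤ (Real.sqrt A + Real.sqrt B) ^ 2 := by nlinarith [hst]
  have h3 : (Real.sqrt A - Real.sqrt B) ^ 2 * (1 / 4) ≤ (Real.sqrt A - Real.sqrt B) ^ 2 * (Real.sqrt A + Real.sqrt B) ^ 2 :=
    mul_le_mul_of_nonneg_left hsum (sq_nonneg _)
  linarith

omit [NeZero L] in
/-- The squared distance of two central lifts in components. [folklore] -/
theorem norm_liftQuat_sub_liftQuat_sq (σ : ℝ) (v z : Fin 3 → ℝ) :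
    ‖liftQuat σ v - liftQuat σ z‖ ^ 2 =
      (σ * Real.sqrt (1 - ((v 0) ^ 2 + (v 1) ^ 2 + (v 2) ^ 2)) - σ * Real.sqrt (1 - ((z 0) ^ 2 + (z 1) ^ 2 + (z 2) ^ 2))) ^ 2 +
        ((v 0 - z 0) ^ 2 + (v 1 - z 1) ^ 2 + (v 2 - z 2) ^ 2) := by
  have h := norm_sq_eq_re_sq_add_imDot (liftQuat σ v - liftQuat σ z)
  simp only [Quaternion.re_sub, Quaternion.imI_sub, Quaternion.imJ_sub, Quaternion.imK_sub] at h
  rw [h]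
  simp only [liftQuat]
  ring

omit [NeZero L] in
/-- ★ **The central lift is `√17`-Lipschitz on a hemisphere half**: for `|v|², |z|² ≤ 1` and `√(1 − |v|²) ≥ ½`,
`‖liftQuat σ v − liftQuat σ z‖² ≤ 17·|v − z|²` (`σ² = 1`; the radial parts differ by `≤ 4|v − z|`). [folklore] -/
theorem liftQuat_sub_liftQuat_sq_le {σ : ℝ} (hσ : σ ^ 2 = 1) {v z : Fin 3 → ℝ}
    (hv : (v 0) ^ 2 + (v 1) ^ 2 + (v 2) ^ 2 ≤ 1) (hz : (z 0) ^ 2 + (z 1) ^ 2 + (z 2) ^ 2 ≤ 1)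
    (hre : (1 / 2 : ℝ) ≤ Real.sqrt (1 - ((v 0) ^ 2 + (v 1) ^ 2 + (v 2) ^ 2))) :
    ‖liftQuat σ v - liftQuat σ z‖ ^ 2 ≤ 17 * ((v 0 - z 0) ^ 2 + (v 1 - z 1) ^ 2 + (v 2 - z 2) ^ 2) := by
  have hA0 : 0 ≤ 1 - ((v 0) ^ 2 + (v 1) ^ 2 + (v 2) ^ 2) := by linarith
  have hB0 : 0 ≤ 1 - ((z 0) ^ 2 + (z 1) ^ 2 + (z 2) ^ 2) := by linarith
  have h1 := sqrt_sub_sqrt_sq_le hA0 hB0 hre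
  have h2 := radial_arg_sub_sq_le hv hz
  have hσst : (σ * Real.sqrt (1 - ((v 0) ^ 2 + (v 1) ^ 2 + (v 2) ^ 2)) - σ * Real.sqrt (1 - ((z 0) ^ 2 + (z 1) ^ 2 + (z 2) ^ 2))) ^ 2 =
      (Real.sqrt (1 - ((v 0) ^ 2 + (v 1) ^ 2 + (v 2) ^ 2)) - Real.sqrt (1 - ((z 0) ^ 2 + (z 1) ^ 2 + (z 2) ^ 2))) ^ 2 := by
    rw [← mul_sub, mul_pow, hσ, one_mul]
  rw [norm_liftQuat_sub_liftQuat_sq, hσst]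
  linarith [h1, h2]

omit [NeZero L] in
/-- The squared norm of the imaginary part of a unit quaternion in the letters of ✓`liftQuat`: `√(1 − |Im q(U)|²) = |Re q(U)|`. [folklore] -/
theorem sqrt_one_sub_im_sq_eq (U : SU2) :
    Real.sqrt (1 - ((su2Quat U).imI ^ 2 + (su2Quat U).imJ ^ 2 + (su2Quat U).imK ^ 2)) = |(su2Quat U).re| := by
  have h1 : Quaternion.normSq (su2Quat U) = 1 := normSq_su2Quat U
  rw [Quaternion.normSq_def'] at h1
  have hre2 : (su2Quat U).re ^ 2 = 1 - ((su2Quat U).imI ^ 2 + (su2Quat U).imJ ^ 2 + (su2Quat U).imK ^ 2) := by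
    have := h1; simp only [sq] at this ⊢; linarith
  rw [← hre2, Real.sqrt_sq_eq_abs]

omit [NeZero L] in
/-- ★ **A unit quaternion on the hemisphere of `σ` versus a central lift**: if `σ·Re q(U) ≥ ½` then
`‖q(U) − liftQuat σ z‖² ≤ 17·|Im q(U) − z|²` (`|z|² ≤ 1`, `σ = ±1`). [folklore] -/
theorem su2Quat_sub_liftQuat_sq_le {σ : ℝ} (hσ : σ = 1 ∨ σ = -1) (U : SU2) (hhem : (1 / 2 : ℝ) ≤ σ * (su2Quat U).re)
    {z : Fin 3 → ℝ} (hz : (z 0) ^ 2 + (z 1) ^ 2 + (z 2) ^ 2 ≤ 1) :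
    ‖su2Quat U - liftQuat σ z‖ ^ 2 ≤
      17 * (((su2Quat U).imI - z 0) ^ 2 + ((su2Quat U).imJ - z 1) ^ 2 + ((su2Quat U).imK - z 2) ^ 2) := by
  have hσ2 : σ ^ 2 = 1 := sq_eq_one_of_sign hσ
  have him := im_sq_le_one U
  set v : Fin 3 → ℝ := ![(su2Quat U).imI, (su2Quat U).imJ, (su2Quat U).imK] with hv
  have hv0 : v 0 = (su2Quat U).imI := rfl
  have hv1 : v 1 = (su2Quat U).imJ := rfl
  have hv2 : v 2 = (su2Quat U).imK := rfl
  have hvle : (v 0) ^ 2 + (v 1) ^ 2 + (v 2) ^ 2 ≤ 1 := by rw [hv0, hv1, hv2]; exact him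
  have hU : su2Quat U = liftQuat σ v := by
    have h := centralRep_im_su2Quat hσ U (by linarith)
    rw [← hv] at h
    rw [← su2Quat_centralRep hσ2 hvle, h]
  have hre : (1 / 2 : ℝ) ≤ Real.sqrt (1 - ((v 0) ^ 2 + (v 1) ^ 2 + (v 2) ^ 2)) := by
    rw [hv0, hv1, hv2, sqrt_one_sub_im_sq_eq]
    have habs : σ * (su2Quat U).re ≤ |(su2Quat U).re| := by
      rcases hσ with h | h <;> subst h
      · rw [one_mul]; exact le_abs_self _
      · rw [neg_one_mul]; exact neg_le_abs _
    linarith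
  have h := liftQuat_sub_liftQuat_sq_le hσ2 hvle hz hre
  rw [hU]
  rw [hv0, hv1, hv2] at h
  exact h

omit [NeZero L] in
/-- **Jensen for block averages**: if every `f v` is within `√R` of `b` (sum of three squares) then so is the average `(Σ_v f v)/#S`. [folklore] -/
theorem avg_sub_sq_le {ι : Type*} (S : Finset ι) (hS : S.Nonempty) (f : ι → Fin 3 → ℝ) (b : Fin 3 → ℝ) {R : ℝ}
    (h : ∀ v ∈ S, (f v 0 - b 0) ^ 2 + (f v 1 - b 1) ^ 2 + (f v 2 - b 2) ^ 2 ≤ R) :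
    ((∑ v ∈ S, f v 0) / (S.card : ℝ) - b 0) ^ 2 + ((∑ v ∈ S, f v 1) / (S.card : ℝ) - b 1) ^ 2 +
        ((∑ v ∈ S, f v 2) / (S.card : ℝ) - b 2) ^ 2 ≤ R := by
  have hn : (0 : ℝ) < (S.card : ℝ) := by exact_mod_cast hS.card_pos
  have hn0 : (S.card : ℝ) ≠ 0 := hn.ne'
  -- centre
  have hc : ∀ a : Fin 3, (∑ v ∈ S, f v a) / (S.card : ℝ) - b a = (∑ v ∈ S, (f v a - b a)) / (S.card : ℝ) := fun a => by
    rw [Finset.sum_sub_distrib, Finset.sum_const, nsmul_eq_mul, sub_div, mul_div_cancel_left₀ _ hn0]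
  -- Cauchy–Schwarz per component
  have hcs : ∀ a : Fin 3, ((∑ v ∈ S, (f v a - b a)) / (S.card : ℝ)) ^ 2 ≤ (∑ v ∈ S, (f v a - b a) ^ 2) / (S.card : ℝ) := fun a => by
    rw [div_pow, div_le_div_iff₀ (by positivity) hn]
    have h1 := sq_sum_le_card_mul_sum_sq (s := S) (f := fun v => f v a - b a)
    calc (∑ v ∈ S, (f v a - b a)) ^ 2 * (S.card : ℝ) ≤ ((S.card : ℝ) * ∑ v ∈ S, (f v a - b a) ^ 2) * (S.card : ℝ) :=
          mul_le_mul_of_nonneg_right h1 hn.le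
      _ = (∑ v ∈ S, (f v a - b a) ^ 2) * (S.card : ℝ) ^ 2 := by ring
  rw [hc 0, hc 1, hc 2]
  have hsum : (∑ v ∈ S, (f v 0 - b 0) ^ 2) / (S.card : ℝ) + (∑ v ∈ S, (f v 1 - b 1) ^ 2) / (S.card : ℝ) +
      (∑ v ∈ S, (f v 2 - b 2) ^ 2) / (S.card : ℝ) ≤ R := by
    rw [← add_div, ← add_div, ← Finset.sum_add_distrib, ← Finset.sum_add_distrib, div_le_iff₀ hn]
    calc ∑ v ∈ S, ((f v 0 - b 0) ^ 2 + (f v 1 - b 1) ^ 2 + (f v 2 - b 2) ^ 2) ≤ ∑ _v ∈ S, R := Finset.sum_le_sum h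
      _ = R * (S.card : ℝ) := by rw [Finset.sum_const, nsmul_eq_mul, mul_comm]
  linarith [hcs 0, hcs 1, hcs 2]

omit [NeZero L] in
/-- **The quaternion commutator is `2`-Lipschitz in each unit argument**: `‖[a,b] − [a',b']‖ ≤ 2‖a − a'‖ + 2‖b − b'‖` for unit `a, b, a', b'`
(`[a,b] = ab − ba`). [folklore] -/
theorem norm_comm_sub_comm_le {a b a' b' : ℍ} (ha : ‖a‖ = 1) (hb : ‖b‖ = 1) (ha' : ‖a'‖ = 1) (hb' : ‖b'‖ = 1) :
    ‖(a * b - b * a) - (a' * b' - b' * a')‖ ≤ 2 * ‖a - a'‖ + 2 * ‖b - b'‖ := by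
  have e : (a * b - b * a) - (a' * b' - b' * a') = (a - a') * b + a' * (b - b') - ((b - b') * a + b' * (a - a')) := by noncomm_ring
  rw [e]
  calc ‖(a - a') * b + a' * (b - b') - ((b - b') * a + b' * (a - a'))‖
      ≤ ‖(a - a') * b + a' * (b - b')‖ + ‖(b - b') * a + b' * (a - a')‖ := norm_sub_le _ _
    _ ≤ (‖(a - a') * b‖ + ‖a' * (b - b')‖) + (‖(b - b') * a‖ + ‖b' * (a - a')‖) := add_le_add (norm_add_le _ _) (norm_add_le _ _)
    _ = 2 * ‖a - a'‖ + 2 * ‖b - b'‖ := by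
        rw [norm_mul, norm_mul, norm_mul, norm_mul, ha, hb, ha', hb']; ring

/-! ## §2 The shadow representatives versus the central lifts of the block averages -/

/-- The wrap-block average in components: `blockIm S k P a = (Σ_{v ∈ S} Im_a q(P.1 v.1 (v.2,k)))/#S`. [folklore] -/
theorem blockIm_apply (S : Finset (Fin (2 * L - 1 + 1) × Site 3 L)) (k : Fin 3)
    (P : (Fin (2 * L - 1 + 1) → GaugeConfig 3 L SU2) × (Site 3 L → SU2)) :
    blockIm L S k P 0 = (∑ v ∈ S, (su2Quat (P.1 v.1 (v.2, k))).imI) / (S.card : ℝ) ∧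
      blockIm L S k P 1 = (∑ v ∈ S, (su2Quat (P.1 v.1 (v.2, k))).imJ) / (S.card : ℝ) ∧
      blockIm L S k P 2 = (∑ v ∈ S, (su2Quat (P.1 v.1 (v.2, k))).imK) / (S.card : ℝ) := by
  refine ⟨?_, ?_, ?_⟩ <;> simp [blockIm]

/-- The seam average in components. [folklore] -/
theorem seamIm_apply (P : (Fin (2 * L - 1 + 1) → GaugeConfig 3 L SU2) × (Site 3 L → SU2)) :
    seamIm L P 0 = (∑ x : Site 3 L, (su2Quat (P.2 x)).imI) / ((Finset.univ : Finset (Site 3 L)).card : ℝ) ∧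
      seamIm L P 1 = (∑ x : Site 3 L, (su2Quat (P.2 x)).imJ) / ((Finset.univ : Finset (Site 3 L)).card : ℝ) ∧
      seamIm L P 2 = (∑ x : Site 3 L, (su2Quat (P.2 x)).imK) / ((Finset.univ : Finset (Site 3 L)).card : ℝ) := by
  have hcardS : (((Finset.univ : Finset (Site 3 L)).card : ℕ) : ℝ) = (L : ℝ) ^ 3 := by
    rw [Finset.card_univ, Fintype.card_pi, Finset.prod_const, Finset.card_univ, Fintype.card_fin, ZMod.card]; push_cast; ring
  rw [hcardS]
  refine ⟨?_, ?_, ?_⟩ <;> simp [seamIm]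

/-- ★★ **The wrap representative versus the central lift of the wrap-block average**: with slice `0` in comb gauge and `σ_k·Re q(w_k) ≥ ½`,
`‖q(w_k) − liftQuat σ_k z_k‖² ≤ 17·(16L²·√F₀(P))²`, `z_k = blockIm (wrapBlock k) k P` (every wrap link is within `16L²√F₀` of `w_k`, Jensen, and the
`√17`-Lipschitz lift). [cite: Luscher1983, §2] -/
theorem norm_sq_wrapRep_sub_lift_blockIm_le (P : (Fin (2 * L - 1 + 1) → GaugeConfig 3 L SU2) × (Site 3 L → SU2))
    (ht : treeGauge (P.1 0) = 1) {σ : ℝ} (hσ : σ = 1 ∨ σ = -1) (k : Fin 3)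
    (hhem : (1 / 2 : ℝ) ≤ σ * (su2Quat (wrapReps (P.1 0) k)).re) :
    ‖su2Quat (wrapReps (P.1 0) k) - liftQuat σ (blockIm L (wrapBlock L k) k P)‖ ^ 2 ≤
      17 * (16 * (L : ℝ) ^ 2 * Real.sqrt (ringDeficit L (fun _ => false) P)) ^ 2 := by
  set δ := Real.sqrt (ringDeficit L (fun _ => false) P) with hδ
  have hδ0 : 0 ≤ δ := Real.sqrt_nonneg _
  have hL1 : (1 : ℝ) ≤ L := by exact_mod_cast NeZero.one_le
  set w := wrapReps (P.1 0) k with hw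
  -- every wrap link is within `16L²δ` of `w`
  have hlink : ∀ v ∈ wrapBlock L k, ((su2Quat (P.1 v.1 (v.2, k))).imI - (su2Quat w).imI) ^ 2 +
      ((su2Quat (P.1 v.1 (v.2, k))).imJ - (su2Quat w).imJ) ^ 2 + ((su2Quat (P.1 v.1 (v.2, k))).imK - (su2Quat w).imK) ^ 2 ≤
      (16 * (L : ℝ) ^ 2 * δ) ^ 2 := by
    intro v hv
    have hvk : v.2 k = -1 := (mem_wrapBlock k v).1 hv
    have h1 := fd_slice_combShadow_le P ht v.1 (v.2, k)
    rw [combFlat_apply] at h1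
    simp only [hvk, if_true] at h1
    have h2 : fd (P.1 v.1 (v.2, k)) w ≤ 16 * (L : ℝ) ^ 2 * δ := h1.trans (mul_le_mul_of_nonneg_right (four_add_twelve_sq_le hL1) hδ0)
    have h3 := norm_su2Quat_sub_le_fd (P.1 v.1 (v.2, k)) w
    have hfd0 : 0 ≤ fd (P.1 v.1 (v.2, k)) w := by unfold fd; exact frobNorm_nonneg _
    calc _ ≤ ‖su2Quat (P.1 v.1 (v.2, k)) - su2Quat w‖ ^ 2 := im_sub_sq_le_norm_sub_sq _ _
      _ ≤ fd (P.1 v.1 (v.2, k)) w ^ 2 := pow_le_pow_left₀ (norm_nonneg _) h3 2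
      _ ≤ (16 * (L : ℝ) ^ 2 * δ) ^ 2 := pow_le_pow_left₀ hfd0 h2 2
  -- Jensen
  have havg := avg_sub_sq_le (wrapBlock L k) (wrapBlock_nonempty k)
    (fun v => ![(su2Quat (P.1 v.1 (v.2, k))).imI, (su2Quat (P.1 v.1 (v.2, k))).imJ, (su2Quat (P.1 v.1 (v.2, k))).imK])
    ![(su2Quat w).imI, (su2Quat w).imJ, (su2Quat w).imK] (R := (16 * (L : ℝ) ^ 2 * δ) ^ 2) (fun v hv => by simpa using hlink v hv)
  obtain ⟨hb0, hb1, hb2⟩ := blockIm_apply (wrapBlock L k) k P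
  have hz := normSq_blockIm_le_one (wrapBlock L k) k P
  have h := su2Quat_sub_liftQuat_sq_le hσ w hhem hz
  refine h.trans (mul_le_mul_of_nonneg_left ?_ (by norm_num))
  rw [hb0, hb1, hb2]
  have e : ∀ p q : ℝ, (p - q) ^ 2 = (q - p) ^ 2 := fun p q => by ring
  rw [e, e ((su2Quat w).imJ), e ((su2Quat w).imK)]
  simpa using havg

/-- ★★ **The seam base value versus the central lift of the seam average**: with slice `0` in comb gauge and `σ₄·Re q(P.2 0) ≥ ½`,
`‖q(P.2 0) − liftQuat σ₄ z₄‖² ≤ 17·(12L²·√F₀(P))²`, `z₄ = seamIm P`. [cite: Luscher1983, §2] -/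
theorem norm_sq_seam_sub_lift_seamIm_le (P : (Fin (2 * L - 1 + 1) → GaugeConfig 3 L SU2) × (Site 3 L → SU2))
    (ht : treeGauge (P.1 0) = 1) {σ₄ : ℝ} (hσ₄ : σ₄ = 1 ∨ σ₄ = -1) (hhem : (1 / 2 : ℝ) ≤ σ₄ * (su2Quat (P.2 0)).re) :
    ‖su2Quat (P.2 0) - liftQuat σ₄ (seamIm L P)‖ ^ 2 ≤ 17 * (12 * (L : ℝ) ^ 2 * Real.sqrt (ringDeficit L (fun _ => false) P)) ^ 2 := by
  set δ := Real.sqrt (ringDeficit L (fun _ => false) P) with hδ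
  set c := P.2 0 with hc
  have hlink : ∀ x ∈ (Finset.univ : Finset (Site 3 L)), ((su2Quat (P.2 x)).imI - (su2Quat c).imI) ^ 2 +
      ((su2Quat (P.2 x)).imJ - (su2Quat c).imJ) ^ 2 + ((su2Quat (P.2 x)).imK - (su2Quat c).imK) ^ 2 ≤ (12 * (L : ℝ) ^ 2 * δ) ^ 2 := by
    intro x _
    have h2 := fd_seam_combShadow_le P ht x
    have h3 := norm_su2Quat_sub_le_fd (P.2 x) c
    have hfd0 : 0 ≤ fd (P.2 x) c := by unfold fd; exact frobNorm_nonneg _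
    calc _ ≤ ‖su2Quat (P.2 x) - su2Quat c‖ ^ 2 := im_sub_sq_le_norm_sub_sq _ _
      _ ≤ fd (P.2 x) c ^ 2 := pow_le_pow_left₀ (norm_nonneg _) h3 2
      _ ≤ (12 * (L : ℝ) ^ 2 * δ) ^ 2 := pow_le_pow_left₀ hfd0 h2 2
  have havg := avg_sub_sq_le (Finset.univ : Finset (Site 3 L)) Finset.univ_nonempty
    (fun x => ![(su2Quat (P.2 x)).imI, (su2Quat (P.2 x)).imJ, (su2Quat (P.2 x)).imK])
    ![(su2Quat c).imI, (su2Quat c).imJ, (su2Quat c).imK] (R := (12 * (L : ℝ) ^ 2 * δ) ^ 2) (fun x hx => by simpa using hlink x hx)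
  obtain ⟨hb0, hb1, hb2⟩ := seamIm_apply P
  have hz := normSq_seamIm_le_one P
  have h := su2Quat_sub_liftQuat_sq_le hσ₄ c hhem hz
  refine h.trans (mul_le_mul_of_nonneg_left ?_ (by norm_num))
  rw [hb0, hb1, hb2]
  have e : ∀ p q : ℝ, (p - q) ^ 2 = (q - p) ^ 2 := fun p q => by ring
  rw [e, e ((su2Quat c).imJ), e ((su2Quat c).imK)]
  simpa using havg

end Summit.QuantumFields.YangMills.Theorems.VirialFluxGap.CentralCoercivity

end
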